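import Summits.RiemannHypothesis.RiemannHypothesis.Theorems.TiltedLandingLaw421R3Lens1Pinning
import Summits.RiemannHypothesis.RiemannHypothesis.Theorems.TiltedLandingLaw421R3Lens1TopChild
import Summits.RiemannHypothesis.RiemannHypothesis.Theorems.TiltedLandingLaw421R3ColumnImmunity2

/-!
# TiltedLandingLaw421R3 — lens-1 stub-1 REPAIR: TOP-OF-CLUSTER PINNING WITH HEIGHT TOLERANCE, typed, and its kernel reduction

IMAGE «Lens1PinningTol» v2 (tenure rh-tenure-earlyapp-1 g20; director-rh g29 (CA920)(2) repair order, (CA923) repair of record r0 ADOPTED,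
(CA923)(3) image path, RSV-105; landing target `…/Theorems/TiltedLandingLaw421R3Lens1PinningTol.lean`, `--supports stmt-RiemannHypothesis-33346
--as helper`).  SUPPORT, K only: every law-like item is a `def … : Prop`; nothing here asserts a law; RH is NOT proved; ⟨33346⟩/⟨33347⟩ OPEN.
THREE imports, all LANDED: `…R3Lens1Pinning` (#1243: `TopPinning`, `NoTallerToucher`, `UmbrellaTop`, `RegUmbrella11S`, `succ_or_umbrella`,
`regHungCut10S_of_topPinning`; it carries the SUCC interface `RegHungCut10S` of `…R3Lens1CoverageRS2` and `stTrkDQ_succ_of_nested`) and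
`…R3Lens1TopChild` (#1229, lens-1 g8) for the pinning disjunction `RhW08.Lens1TopChild.PinnedTopAt f k z` (= the conclusion of `TopPinning` read
at `z`) and `…R3ColumnImmunity2` (`RhW08.Column.thief_in_wing`: an out-of-band upper zero of `f^{(j)}` lies beyond the wall `R/2 < |Re a − x₀|`;
+1 module to the cone), both CITED BY NAME — no twin definition, no re-derived tree step (dedup (CA899); the un-announced scratch a49f39d1 re-defined
the disjunction as `Pinned` and inlined the wall step; superseded).

WHY.  CAND 4 (C6 rh-idea-4 g44, exact certificates EQH-231-1864 @ g = 652/659; director (CA920)) kills `RhW08.Lens1Pinning.TopPinning` AS TYPED: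
its hypothesis `NoTallerToucher` leaves EQUAL-HEIGHT touching mates unrestricted, and on the witness the top zero `a = i` of `F` is unpinned while
its equal-height mate `b = 0.231 + i` IS pinned (`NestedStep b w`, `w ≈ 0.1272 + 0.9919·i`).  The kernel (`succ_or_umbrella`) never needed the
pinned zero to be the top itself — only to be a level-`j` zero it can feed to `stTrkDQ_succ_of_nested` (if a band state) or to an umbrella
residual (if not).  So the repaired law lets the pinned zero be ANY direct disc-toucher `a'` of the top `a` within a height tolerance `θ`.

CONTENT.
§1 ★ `TopPinningTol θ` («TopPinning′(θ)»): `TopPinning`'s binders VERBATIM, conclusion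
   `∃ a', f⁽ʲ⁾ a' = 0 ∧ (1 − θ)·Im a ≤ Im a' ≤ Im a ∧ |Re a − Re a'| ≤ Im a + Im a' ∧ PinnedTopAt f j a'` · (K)
   `topPinningTol_of_topPinning` (`0 ≤ θ`, witness `a' := a`: whatever is ever proved TOWARDS `TopPinning` transfers) · (K) `topPinningTol_mono`.
§2 (K) `readyR2_of_band_window_nl`: a real NL event in the Jensen window `|x − Re c| ≤ Im c` of ANY level-`j` band state `c` makes level `j`
   Ready′ (`ReadyR2`) — the range step of `succ_or_umbrella` :99–:106, isolated (slack = `band_radius_lt_range'`).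
§3 `UmbrellaLow θ …` (NEW umbrella, LOW form: the TALLEST level-`j` band state `T` is disc-touched by a zero `b` of `f⁽ʲ⁾` at height
   `(1 − θ)·Im T ≤ Im b ≤ Im T` which is NOT a band state and which is pinned, `PinnedTopAt f j b`) · ★ `RegUmbrellaLowS θ` (NEW typed open residual:
   `RegUmbrella11S`'s binders VERBATIM with `UmbrellaTop` replaced by `UmbrellaLow θ` ⇒ a level-(j+1) band state) · (K)
   `umbrellaLow_beyond_wall` (`θ < 1`): the low umbrella zero lies strictly outside the closed column, `R/2 < |Re b − x₀|` (`thief_in_wing`).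
§4 (K) ★★ `succ_or_umbrellaTol`: `TopPinningTol θ` + a level-`j` band state + not Ready′ ⇒ successor ∨ `UmbrellaTop` ∨ `UmbrellaLow θ`
   (a strictly taller toucher of `T` still routes to `UmbrellaTop`; a pinned `a'` IN the band gives the successor or — NL mode — Ready′, hence
   is excluded; a pinned `a'` OUT of the band is the low umbrella) · (K) ★★ `regHungCut10S_of_topPinningTol :
   TopPinningTol θ → RegUmbrella11S → RegUmbrellaLowS θ → RegHungCut10S` for EVERY `θ` (the v13q residual `RegUmbrella11S` is kept VERBATIM;
   at `θ = 0` with `TopPinning` itself this is #1243's `regHungCut10S_of_topPinning` plus one redundant hypothesis — not restated).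
The tolerance `θ` is a parameter throughout (director (CA923)(1): the drawer's two SUCC stubs share ONE `θ₀`, provisional `1/10`, final after
C6's bench); no constant is fixed in this file.  No twin of an importable statement; tree facts are cited by name (`levelFinite_stTrkDQ`,
`exists_upper_zero_of_nonreal`, `stTrkDQ_succ_of_nested`, `abs_re_sub_le_of_stTrkDQ`, `band_radius_lt_range'`, `R_pos_of_engine`,
`cumReady_of_ready`, `thief_in_wing`, `PinnedTopAt`).
-/

namespace RhW08.Lens1PinningTol

open Complex Set
open scoped ComplexConjugate
open Literature.Analysis.Complex
open Summit.RiemannHypothesis.RiemannHypothesis.Theorems.Splittings.JensenWindow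
open RhIdea6.G17.W07C7 RhIdea6.G17.W07C7.Rev6 RhIdea6.G18.W07C8.Law421BirthS RhIdea6.G19.W07C11.Seam
open RhIdea6.G20.W07C12.Frac RhIdea6.G20.W07C12.StColP RhW07.C12.FieldSplit RhIdea6.G21.W07C13.TentMax
open RhW07.C14.TwoSided RhW07.C14.Classes RhW07.C14.Lineage RhW07.C14.Booking
open RhW07.C13.Heredity RhIdea6.G22.W07C15pre.Injection RhW07.E3.Cell RhW07.E3.Lit
open RhW08.Round1 RhW08.StSwap RhW08.Round2 RhW08.QuadW RhW08.SealSwapQ RhW08.SealSwap RhW08.SuccB RhW08.SuccSplit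
open RhW08.SuccTheft RhW08.Column RhW08.Hurwitz RhW08.ClusterQ RhW08.ClusterQM RhW08.NewtonDoor RhW08.NewtonDoorGenusOne RhW08.PurseP
open RhW08.Lens1SignCut RhW08.Lens1Coverage RhW08.Lens1Pinning
open RhW08.Lens1TopChild (PinnedTopAt)

/-! ## §1 The tolerant pinning law -/

/-- ★ TYPED OPEN LAW — TOP-OF-CLUSTER PINNING WITH HEIGHT TOLERANCE `θ` («TopPinning′(θ)», director (CA920)(2)/(CA923)): on a legal frame, for
an upper zero `a` of `f^{(j)}` with no strictly taller toucher, SOME zero `a'` of `f^{(j)}` whose closed disc touches `a`'s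
(`|Re a − Re a'| ≤ Im a + Im a'`), at height `(1 − θ)·Im a ≤ Im a' ≤ Im a`, is pinned (`RhW08.Lens1TopChild.PinnedTopAt`: a non-real zero of `f^{(j+1)}` nested in its CLOSED
disc, or an NL event of `f^{(j)}` in its real window).  (`a' = a` is allowed; `θ = 0`, `a' := a` is the
conclusion of `RhW08.Lens1Pinning.TopPinning`.) -/
def TopPinningTol (θ : ℝ) : Prop :=
  ∀ (η : ℝ) (f : ℂ → ℂ) (x₀ s hmax R Hs : ℝ) (B : ℕ), EngineHyps5 2 η f x₀ s hmax R Hs B → ∀ (j : ℕ) (a : ℂ),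
    iteratedDeriv j f a = 0 → 0 < a.im → NoTallerToucher f j a →
    ∃ a' : ℂ, iteratedDeriv j f a' = 0 ∧ (1 - θ) * a.im ≤ a'.im ∧ a'.im ≤ a.im ∧ |a.re - a'.re| ≤ a.im + a'.im ∧ PinnedTopAt f j a'

/-- (K) `TopPinning` implies the tolerant law for every `θ ≥ 0` (witness `a' := a`). -/
theorem topPinningTol_of_topPinning {θ : ℝ} (hθ : 0 ≤ θ) (h : TopPinning) : TopPinningTol θ := by
  intro η f x₀ s hmax R Hs B hE j a ha hapos hnt
  refine ⟨a, ha, ?_, le_rfl, ?_, h η f x₀ s hmax R Hs B hE j a ha hapos hnt⟩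
  · nlinarith
  · rw [sub_self, abs_zero]; linarith

/-- (K) the tolerant law is monotone in the tolerance. -/
theorem topPinningTol_mono {θ θ' : ℝ} (hθ : θ ≤ θ') (h : TopPinningTol θ) : TopPinningTol θ' := by
  intro η f x₀ s hmax R Hs B hE j a ha hapos hnt
  obtain ⟨a', ha', hlo, hhi, htouch, hpin⟩ := h η f x₀ s hmax R Hs B hE j a ha hapos hnt
  exact ⟨a', ha', by nlinarith, hhi, htouch, hpin⟩

/-! ## §2 An NL event in a band state's window makes the level Ready′ -/

/-- (K) A real NL event of `f^{(j)}` in the Jensen window `|x − Re c| ≤ Im c` of ANY level-`j` band state `c` lies in the tilt range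
`|x − x₀| < (j+3)·R/2` (`abs_re_sub_le_of_stTrkDQ` + `band_radius_lt_range'`), so level `j` is Ready′ (at every state `v`). -/
theorem readyR2_of_band_window_nl {η : ℝ} {f : ℂ → ℂ} {x₀ s hmax R Hs : ℝ} {B j : ℕ} {c : ℂ} {x : ℝ}
    (hE : EngineHyps5 2 η f x₀ s hmax R Hs B) (hc : StTrkDQ η f x₀ s hmax R Hs B j c) (hx : |x - c.re| ≤ c.im) (hNL : NLEventOf f j x)
    (v : ℂ) : ReadyR2 η f x₀ s hmax R Hs B j v := by
  have hHs : 0 ≤ Hs := hE.2.2.2.2.2.2.2.1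
  have h2Hs : 2 * Hs ≤ R := hE.2.2.2.2.2.2.2.2.2.1
  have hrad := band_radius_lt_range' hHs h2Hs (R_pos_of_engine hE) j
  have hre := abs_re_sub_le_of_stTrkDQ hHs hc
  have hcim : c.im ≤ Hs := hc.2.2.2.2
  have hrange : |x - x₀| < ((j : ℝ) + 3) * R / 2 := by
    calc |x - x₀| ≤ |x - c.re| + |c.re - x₀| := abs_sub_le x c.re x₀
      _ ≤ c.im + (R / 2 + Real.sqrt j * Hs) := add_le_add hx hre
      _ < ((j : ℝ) + 3) * R / 2 := by linarith
  have ht : TiltReady η f x₀ s hmax R Hs B j v := ⟨x, hrange, hNL⟩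
  exact cumReady_of_ready (Ready := WinOrTilt) (Or.inr ht)

/-! ## §3 The low umbrella and its residual -/

/-- UMBRELLA (LOW form): the TALLEST level-`j` band state `T` is disc-touched by a zero `b` of `f^{(j)}` at height `(1 − θ)·Im T ≤ Im b ≤ Im T`
which is NOT a band state (hence beyond the wall, `umbrellaLow_beyond_wall`) and which is pinned (`PinnedTopAt`). -/
def UmbrellaLow (θ : ℝ) (η : ℝ) (f : ℂ → ℂ) (x₀ s hmax R Hs : ℝ) (B : ℕ) (j : ℕ) : Prop :=
  ∃ T b : ℂ, StTrkDQ η f x₀ s hmax R Hs B j T ∧ (∀ w : ℂ, StTrkDQ η f x₀ s hmax R Hs B j w → w.im ≤ T.im) ∧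
    iteratedDeriv j f b = 0 ∧ (1 - θ) * T.im ≤ b.im ∧ b.im ≤ T.im ∧ |T.re - b.re| ≤ T.im + b.im ∧
    ¬ StTrkDQ η f x₀ s hmax R Hs B j b ∧ PinnedTopAt f j b

/-- ★ TYPED OPEN RESIDUAL — `RegUmbrellaLowS θ`: the binders of `RhW08.Lens1Pinning.RegUmbrella11S` VERBATIM with `UmbrellaTop` replaced by
`UmbrellaLow θ` ⇒ a level-(j+1) band state. -/
def RegUmbrellaLowS (θ : ℝ) : Prop :=
  ∀ (η : ℝ) (f : ℂ → ℂ) (x₀ s hmax R Hs : ℝ) (B : ℕ), EngineHyps5 2 η f x₀ s hmax R Hs B → ∀ (j : ℕ) (v : ℂ),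
    IsLowest StTrkDQ η f x₀ s hmax R Hs B j v → ¬ ReadyR2 η f x₀ s hmax R Hs B j v →
    ¬ AllInBandInRangeWindow f x₀ R Hs j v → ¬ Dimple f j v → DiscOverlap f j v →
    iteratedDeriv (j + 1) f v ≠ 0 →
    ¬ CellF f j v → ¬ CellNb f x₀ R Hs j v → ¬ LandingDipDeep f x₀ R Hs j v → ¬ LandingDipW f x₀ R Hs j v →
    ¬ IsolatedNewtonL f x₀ R Hs j v → ¬ HungBox f x₀ R Hs j → (∃ i : ℕ, i ≤ j ∧ ¬ ColumnCuttable f x₀ R Hs i) →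
    UmbrellaLow θ η f x₀ s hmax R Hs B j →
    ∃ u : ℂ, StTrkDQ η f x₀ s hmax R Hs B (j + 1) u

/-- (K) ★ The LOW umbrella zero lies strictly OUTSIDE the closed column (`RhW08.Column.thief_in_wing`, column immunity; needs only
`0 < Im b`, which `θ < 1` provides): it is an out-of-band intruder beyond the wall, touching the top of the band cluster from equal or lower height. -/
theorem umbrellaLow_beyond_wall {θ : ℝ} (hθ : θ < 1) {η : ℝ} {f : ℂ → ℂ} {x₀ s hmax R Hs : ℝ} {B j : ℕ}
    (hE : EngineHyps5 2 η f x₀ s hmax R Hs B) (hU : UmbrellaLow θ η f x₀ s hmax R Hs B j) :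
    ∃ T b : ℂ, StTrkDQ η f x₀ s hmax R Hs B j T ∧ iteratedDeriv j f b = 0 ∧ (1 - θ) * T.im ≤ b.im ∧ b.im ≤ T.im ∧
      |T.re - b.re| ≤ T.im + b.im ∧ PinnedTopAt f j b ∧ R / 2 < |b.re - x₀| := by
  obtain ⟨T, b, hT, -, hb0, hlo, hhi, hble, hnb, hpin⟩ := hU
  have hT' : StTrkDQ η f x₀ s hmax R Hs B j T := hT
  have hbpos : 0 < b.im := lt_of_lt_of_le (mul_pos (by linarith) hT'.2.2.1) hlo
  exact ⟨T, b, hT, hb0, hlo, hhi, hble, hpin, thief_in_wing hE hT'.1 hb0 hbpos hnb⟩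

/-! ## §4 The patched kernel reduction -/

/-- (K) ★★ SUCCESSOR OR UMBRELLA, tolerant form: `TopPinningTol θ` + a level-`j` band state + not Ready′ ⇒ a level-(j+1) band state,
or `UmbrellaTop` (a strictly taller toucher of the tallest band state), or `UmbrellaLow θ` (a pinned out-of-band toucher within the tolerance). -/
theorem succ_or_umbrellaTol {θ : ℝ} (hP : TopPinningTol θ) {η : ℝ} {f : ℂ → ℂ} {x₀ s hmax R Hs : ℝ} {B j : ℕ} {v : ℂ}
    (hE : EngineHyps5 2 η f x₀ s hmax R Hs B) (hv : StTrkDQ η f x₀ s hmax R Hs B j v) (hnR : ¬ ReadyR2 η f x₀ s hmax R Hs B j v) :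
    (∃ u : ℂ, StTrkDQ η f x₀ s hmax R Hs B (j + 1) u) ∨ UmbrellaTop η f x₀ s hmax R Hs B j ∨ UmbrellaLow θ η f x₀ s hmax R Hs B j := by
  classical
  have hfin := levelFinite_stTrkDQ η f x₀ s hmax R Hs B hE j
  obtain ⟨T, hT, hTmax⟩ := Set.exists_max_image _ (fun u : ℂ => u.im) hfin ⟨v, hv⟩
  have hT' : StTrkDQ η f x₀ s hmax R Hs B j T := hT
  by_cases hnt : NoTallerToucher f j T
  · obtain ⟨a', ha'0, hlo, hhi, htouch, hpin⟩ := hP η f x₀ s hmax R Hs B hE j T hT'.2.1 hT'.2.2.1 hnt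
    by_cases hband : StTrkDQ η f x₀ s hmax R Hs B j a'
    · rcases hpin with ⟨w, hw0, hwim, hn⟩ | ⟨x, hx, hNLx⟩
      · obtain ⟨u, hu0, hupos, hure, huim⟩ := exists_upper_zero_of_nonreal hE.1 hE.2.1 (j + 1) hw0 hwim
        have hn' : NestedStep a' u := by
          unfold NestedStep at hn ⊢
          have h2 : u.im ^ 2 = w.im ^ 2 := by rw [← sq_abs, huim, sq_abs]
          rw [hure, h2]; exact hn
        exact Or.inl ⟨u, RhW08.SuccB.stTrkDQ_succ_of_nested hE hband hu0 hupos hn'⟩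
      · exact absurd (readyR2_of_band_window_nl hE hband hx hNLx v) hnR
    · exact Or.inr (Or.inr ⟨T, a', hT', hTmax, ha'0, hlo, hhi, htouch, hband, hpin⟩)
  · right; left
    unfold NoTallerToucher at hnt
    push Not at hnt
    obtain ⟨b, hb0, hbim, hble⟩ := hnt
    exact ⟨T, b, hT', hTmax, hb0, hbim, hble, fun hb => absurd (hTmax b hb) (not_le.mpr hbim)⟩

/-- (K) ★★ THE PATCHED KERNEL REDUCTION: `RegHungCut10S ⟸ TopPinningTol θ ∧ RegUmbrella11S ∧ RegUmbrellaLowS θ`, for every `θ`. -/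
theorem regHungCut10S_of_topPinningTol {θ : ℝ} (hP : TopPinningTol θ) (hU : RegUmbrella11S) (hL : RegUmbrellaLowS θ) :
    RegHungCut10S := by
  intro η f x₀ s hmax R Hs B hE j v hlow hnR hwin hdim hov hz hnF hnNb hnD hnW hnI hB hcut
  rcases succ_or_umbrellaTol hP hE hlow.1 hnR with h | hUmb | hLow
  · exact h
  · exact hU η f x₀ s hmax R Hs B hE j v hlow hnR hwin hdim hov hz hnF hnNb hnD hnW hnI hB hcut hUmb
  · exact hL η f x₀ s hmax R Hs B hE j v hlow hnR hwin hdim hov hz hnF hnNb hnD hnW hnI hB hcut hLow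

end RhW08.Lens1PinningTol
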